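import Summits.AtomisticToContinuum.Crystallization.Theorems.ChartedZeroExcessLayeredLatticeLiouvilleZV

/-!
# Part ZZ «Transport: ε-partners between two exactly charted configurations carry LINK MAPS» (lens-2 g79, NODE 79 rider 9 = the abstract core of
LEMMA B of memo §13; imports ZV)

Pure metric bookkeeping, stated ABSTRACTLY (no crystals, no binders of record): `Ψ, τ` an exact Barlow bond chart of `S` on all of `ℤ³`,
`Φ, τ'` an exact Barlow bond chart of `C` on a domain `D`, both configurations separated (`δS, δC > 2ε`) with BOND-LENGTH CEILINGS `βS, βC`
satisfying `β + 2ε ≤ 28/25`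
(bonds are `0 < dist ≤ 28/25`, tree `IsBond`), and a map `g : ℤ³ → ℤ³` with `g z ∈ D`, `dist (Ψ z) (Φ (g z)) ≤ ε` («`ε`-partners») at the
relevant sites.  Then:
adjacent sites have adjacent partners (`barlowAdj_partner`), partners adjacent in `C`'s chart come from adjacent sites (`barlowAdj_of_partner`), distinct
sites have distinct partners (`eq_of_partner_eq`) — so `g` is a LINK MAP (`IsLinkMap τ τ' g x`, Part ZV) at every site whose twelve neighbours have partners
(`isLinkMap_of_partners`), and on a window whose second neighbourhood has partners the hypotheses `hmaps` / `hnb` of Parts ZW/ZY hold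
(`isLinkMap_window_of_partners`).  At the record `ε = 10⁻⁴`, `βS = 17/16` (two-shell goodness `θ = 1/16`), this is the transport step (B) of the
transverse endgame; the remaining metric input of g80 is C's own chart `Φ, τ'` with its ceiling `βC` and floor `δC` (LEMMA C).
0 sorry.
-/

open Summit.AtomisticToContinuum.Crystallization.Theorems.ChartedPlanarOrderRigidityDoor (E3)

namespace Summit.AtomisticToContinuum.Crystallization.Theorems.ChartedZeroExcessLayeredLatticeLiouville

/-! ## ZZ-1  Two-point facts -/

/-- `ε`-partners move a distance UP by at most `2ε`. [formal bookkeeping] -/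
theorem dist_le_of_partners {P P' Q Q' : E3} {ε : ℝ} (h : dist P Q ≤ ε) (h' : dist P' Q' ≤ ε) : dist Q Q' ≤ dist P P' + 2 * ε := by
  have h4 := dist_triangle4 Q P P' Q'
  rw [dist_comm Q P] at h4
  linarith

/-- … and DOWN by at most `2ε`. [formal bookkeeping] -/
theorem dist_ge_of_partners {P P' Q Q' : E3} {ε : ℝ} (h : dist P Q ≤ ε) (h' : dist P' Q' ≤ ε) : dist P P' ≤ dist Q Q' + 2 * ε := by
  have h4 := dist_triangle4 P Q Q' P'
  rw [dist_comm Q' P'] at h4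
  linarith

/-- the twelve link points of a site are pairwise distinct. [formal bookkeeping] -/
theorem linkPt_injective (τ : ℤ → Bool) (x : ℤ × ℤ × ℤ) : Function.Injective (linkPt τ x) := by
  intro i j h
  apply linkSite_injective (τ (x.1 - 1)) (τ x.1)
  simp only [linkPt, shiftSite, Prod.mk.injEq, add_right_inj] at h
  exact Prod.ext h.1 h.2

/-! ## ZZ-2  Adjacency and distinctness across ε-partners -/

/-- ★ ADJACENT SITES HAVE ADJACENT PARTNERS: an `S`-bond has length `≤ βS`, so the partners are within `βS + 2ε ≤ 28/25`; they are distinct because the two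
atoms are `δS > 2ε` apart. [this file, g79] -/
theorem barlowAdj_partner {S C : Set E3} {D : Set (ℤ × ℤ × ℤ)} {Ψ Φ : ℤ × ℤ × ℤ → E3} {τ τ' : ℤ → Bool}
    {g : ℤ × ℤ × ℤ → ℤ × ℤ × ℤ} {ε δS βS : ℝ} (hΨ : IsBarlowBondChart S Set.univ Ψ τ) (hΦ : IsBarlowBondChart C D Φ τ')
    (hsepS : ∀ p ∈ S, ∀ p' ∈ S, p ≠ p' → δS ≤ dist p p') (hε : 2 * ε < δS) (hgapS : ∀ p ∈ S, ∀ p' ∈ S, IsBond p p' → dist p p' ≤ βS)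
    (hβS : βS + 2 * ε ≤ 28 / 25) {z z' : ℤ × ℤ × ℤ} (hz : g z ∈ D) (hz' : g z' ∈ D) (hd : dist (Ψ z) (Φ (g z)) ≤ ε)
    (hd' : dist (Ψ z') (Φ (g z')) ≤ ε) (hadj : BarlowAdj τ z z') : BarlowAdj τ' (g z) (g z') := by
  have hb : IsBond (Ψ z) (Ψ z') := (hΨ.2.2 z (Set.mem_univ _) z' (Set.mem_univ _)).2 hadj
  have hS : Ψ z ∈ S := hΨ.2.1 (Set.mem_univ z)
  have hS' : Ψ z' ∈ S := hΨ.2.1 (Set.mem_univ z')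
  have hup := dist_le_of_partners hd hd'
  have h1 : dist (Φ (g z)) (Φ (g z')) ≤ 28 / 25 := by have := hgapS _ hS _ hS' hb; linarith
  have h0 : 0 < dist (Φ (g z)) (Φ (g z')) := by
    rcases eq_or_ne (Φ (g z)) (Φ (g z')) with e | e
    · exfalso
      have hne : Ψ z ≠ Ψ z' := fun h => by have h0 := hb.1; rw [h, dist_self] at h0; exact lt_irrefl _ h0
      have hsep := hsepS _ hS _ hS' hne
      have hdn := dist_ge_of_partners hd hd'
      rw [e, dist_self] at hdn
      linarith
    · exact dist_pos.2 e
  exact (hΦ.2.2 _ hz _ hz').1 ⟨h0, h1⟩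

/-- ★ PARTNERS ADJACENT IN `C`'S CHART COME FROM ADJACENT SITES: a `C`-bond has length `≤ βC`, so the atoms are within `βC + 2ε ≤ 28/25`; they are distinct
because the two partner sites are `δC > 2ε` apart. [this file, g79] -/
theorem barlowAdj_of_partner {S C : Set E3} {D : Set (ℤ × ℤ × ℤ)} {Ψ Φ : ℤ × ℤ × ℤ → E3} {τ τ' : ℤ → Bool}
    {g : ℤ × ℤ × ℤ → ℤ × ℤ × ℤ} {ε δC βC : ℝ} (hΨ : IsBarlowBondChart S Set.univ Ψ τ) (hΦ : IsBarlowBondChart C D Φ τ')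
    (hsepC : ∀ c ∈ C, ∀ c' ∈ C, c ≠ c' → δC ≤ dist c c') (hε : 2 * ε < δC) (hgapC : ∀ c ∈ C, ∀ c' ∈ C, IsBond c c' → dist c c' ≤ βC)
    (hβC : βC + 2 * ε ≤ 28 / 25) {z z' : ℤ × ℤ × ℤ} (hz : g z ∈ D) (hz' : g z' ∈ D) (hd : dist (Ψ z) (Φ (g z)) ≤ ε)
    (hd' : dist (Ψ z') (Φ (g z')) ≤ ε) (hadj : BarlowAdj τ' (g z) (g z')) : BarlowAdj τ z z' := by
  have hb : IsBond (Φ (g z)) (Φ (g z')) := (hΦ.2.2 _ hz _ hz').2 hadj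
  have hC : Φ (g z) ∈ C := hΦ.2.1 hz
  have hC' : Φ (g z') ∈ C := hΦ.2.1 hz'
  have hdn := dist_ge_of_partners hd hd'
  have h1 : dist (Ψ z) (Ψ z') ≤ 28 / 25 := by have := hgapC _ hC _ hC' hb; linarith
  have h0 : 0 < dist (Ψ z) (Ψ z') := by
    rcases eq_or_ne (Ψ z) (Ψ z') with e | e
    · exfalso
      have hne : Φ (g z) ≠ Φ (g z') := fun h => by have h0 := hb.1; rw [h, dist_self] at h0; exact lt_irrefl _ h0
      have hsep := hsepC _ hC _ hC' hne
      have hup := dist_le_of_partners hd hd'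
      rw [e, dist_self] at hup
      linarith
    · exact dist_pos.2 e
  exact (hΨ.2.2 z (Set.mem_univ _) z' (Set.mem_univ _)).1 ⟨h0, h1⟩

/-- ★ DISTINCT SITES HAVE DISTINCT PARTNERS (atoms `δS > 2ε` apart cannot share an `ε`-partner). [this file, g79] -/
theorem eq_of_partner_eq {S : Set E3} {Ψ Φ : ℤ × ℤ × ℤ → E3} {τ : ℤ → Bool} {g : ℤ × ℤ × ℤ → ℤ × ℤ × ℤ} {ε δS : ℝ}
    (hΨ : IsBarlowBondChart S Set.univ Ψ τ) (hsepS : ∀ p ∈ S, ∀ p' ∈ S, p ≠ p' → δS ≤ dist p p') (hε : 2 * ε < δS) {z z' : ℤ × ℤ × ℤ}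
    (hd : dist (Ψ z) (Φ (g z)) ≤ ε) (hd' : dist (Ψ z') (Φ (g z')) ≤ ε) (h : g z = g z') : z = z' := by
  have hdn := dist_ge_of_partners hd hd'
  rw [h, dist_self] at hdn
  by_contra hne
  have hne' : Ψ z ≠ Ψ z' := fun e => hne (hΨ.1 (Set.mem_univ _) (Set.mem_univ _) e)
  have hsep := hsepS _ (hΨ.2.1 (Set.mem_univ z)) _ (hΨ.2.1 (Set.mem_univ z')) hne'
  linarith

/-! ## ZZ-3  ★★ Link maps from partners -/

/-- ★★ TRANSPORT: if a site and its twelve neighbours have `ε`-partners in `C`'s chart domain, the partner map is a LINK MAP there.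
[this file, g79] -/
theorem isLinkMap_of_partners {S C : Set E3} {D : Set (ℤ × ℤ × ℤ)} {Ψ Φ : ℤ × ℤ × ℤ → E3} {τ τ' : ℤ → Bool}
    {g : ℤ × ℤ × ℤ → ℤ × ℤ × ℤ} {ε δS δC βS βC : ℝ} (hΨ : IsBarlowBondChart S Set.univ Ψ τ) (hΦ : IsBarlowBondChart C D Φ τ')
    (hsepS : ∀ p ∈ S, ∀ p' ∈ S, p ≠ p' → δS ≤ dist p p') (hεS : 2 * ε < δS) (hgapS : ∀ p ∈ S, ∀ p' ∈ S, IsBond p p' → dist p p' ≤ βS)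
    (hβS : βS + 2 * ε ≤ 28 / 25) (hsepC : ∀ c ∈ C, ∀ c' ∈ C, c ≠ c' → δC ≤ dist c c') (hεC : 2 * ε < δC)
    (hgapC : ∀ c ∈ C, ∀ c' ∈ C, IsBond c c' → dist c c' ≤ βC) (hβC : βC + 2 * ε ≤ 28 / 25) {x : ℤ × ℤ × ℤ} (hx : g x ∈ D)
    (hdx : dist (Ψ x) (Φ (g x)) ≤ ε) (hnD : ∀ i, g (linkPt τ x i) ∈ D) (hnd : ∀ i, dist (Ψ (linkPt τ x i)) (Φ (g (linkPt τ x i))) ≤ ε) :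
    IsLinkMap τ τ' g x :=
  ⟨fun i => barlowAdj_partner hΨ hΦ hsepS hεS hgapS hβS hx (hnD i) hdx (hnd i) (barlowAdj_linkPt τ x i),
    fun i j => ⟨fun h => barlowAdj_partner hΨ hΦ hsepS hεS hgapS hβS (hnD i) (hnD j) (hnd i) (hnd j) h,
      fun h => barlowAdj_of_partner hΨ hΦ hsepC hεC hgapC hβC (hnD i) (hnD j) (hnd i) (hnd j) h⟩,
    fun i j h => linkPt_injective τ x (eq_of_partner_eq hΨ hsepS hεS (hnd i) (hnd j) h)⟩

/-- ★★ THE WINDOW FORM (feeds `hmaps` / `hnb` of Parts ZW / ZY): partners on a site set `A` containing the SECOND neighbourhood of the window `W`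
make the partner map a link map on `W` and at every neighbour of `W`. [this file, g79] -/
theorem isLinkMap_window_of_partners {S C : Set E3} {D : Set (ℤ × ℤ × ℤ)} {Ψ Φ : ℤ × ℤ × ℤ → E3} {τ τ' : ℤ → Bool}
    {g : ℤ × ℤ × ℤ → ℤ × ℤ × ℤ} {ε δS δC βS βC : ℝ} (hΨ : IsBarlowBondChart S Set.univ Ψ τ) (hΦ : IsBarlowBondChart C D Φ τ')
    (hsepS : ∀ p ∈ S, ∀ p' ∈ S, p ≠ p' → δS ≤ dist p p') (hεS : 2 * ε < δS) (hgapS : ∀ p ∈ S, ∀ p' ∈ S, IsBond p p' → dist p p' ≤ βS)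
    (hβS : βS + 2 * ε ≤ 28 / 25) (hsepC : ∀ c ∈ C, ∀ c' ∈ C, c ≠ c' → δC ≤ dist c c') (hεC : 2 * ε < δC)
    (hgapC : ∀ c ∈ C, ∀ c' ∈ C, IsBond c c' → dist c c' ≤ βC) (hβC : βC + 2 * ε ≤ 28 / 25) {A W : Set (ℤ × ℤ × ℤ)}
    (hA : ∀ z ∈ A, g z ∈ D ∧ dist (Ψ z) (Φ (g z)) ≤ ε) (hWA : W ⊆ A) (hW1 : ∀ z ∈ W, ∀ i, linkPt τ z i ∈ A)
    (hW2 : ∀ z ∈ W, ∀ i j, linkPt τ (linkPt τ z i) j ∈ A) :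
    (∀ z ∈ W, IsLinkMap τ τ' g z) ∧ ∀ z ∈ W, ∀ i, IsLinkMap τ τ' g (linkPt τ z i) :=
  ⟨fun z hz => isLinkMap_of_partners hΨ hΦ hsepS hεS hgapS hβS hsepC hεC hgapC hβC (hA z (hWA hz)).1 (hA z (hWA hz)).2 (fun i => (hA _ (hW1 z hz i)).1)
      fun i => (hA _ (hW1 z hz i)).2,
    fun z hz i => isLinkMap_of_partners hΨ hΦ hsepS hεS hgapS hβS hsepC hεC hgapC hβC (hA _ (hW1 z hz i)).1 (hA _ (hW1 z hz i)).2
      (fun j => (hA _ (hW2 z hz i j)).1) fun j => (hA _ (hW2 z hz i j)).2⟩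

end Summit.AtomisticToContinuum.Crystallization.Theorems.ChartedZeroExcessLayeredLatticeLiouville
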